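import Literature.AlgebraicGeometry.Motives.AbelianVarietyGoodReductionConjFrobReductionMap
import Literature.AlgebraicGeometry.Motives.ProperIntegralPointsFrobeniusTranslate
import HarnessLib

/-!
# The twisted reduction identity `(t^σ̃)~ = π(t̃)` for the Frobenius-conjugate datum, UNCONDITIONALLY
# (Shimura 1998, §18.6, proof of Thm. 18.6, p. 129: «`(Y^σ)~ = Ỹ^f` … `(t^σ)~ = π(t̃)`»; Serre–Tate 1968 §1)

Topic `Literature/AlgebraicGeometry/Motives`; namespaces `Literature.AlgebraicGeometry.Motives.AbelianVariety.GoodReductionAt`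
and `Literature.NumberTheory.DiophantineGeometry.IsAbelianSchemeModel`.  THEOREMS ONLY (no definition, no named fact, no
instance; net Literature debt 0).  Cell `hodgecm-mathlib` (D-0151), row II-1, edition «S5c′ ↦ Q5», the LAST byte of the
Q5 background pool (B-p09 RULING 7): the base-point Frobenius-translate slot `GoodReductionAt.SlotT3` of
`Motives/AbelianVarietyGoodReductionConjFrobReductionMap` (the «φ-light» predicate (T3″): for a proper `𝓞ᵥ`-group scheme `𝒳`,
a `K̄`-point `ξ` of `𝒳` over `𝓞ᵥ`, the `Ω`-point `Q` over `(R, f)` lying over `Spec ι ≫ ξ` and an `R`-point `l` of `𝒳` over the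
TWISTED base point `(R, f ∘ γᵥ)` whose generic point is `Spec ι ≫ Spec σ̃ ≫ ξ`: «`l mod 𝔪_R = Spec Frobⁿ_{κ(R)} ≫ (Q mod 𝔪_R)`»)
is DISCHARGED from the (T3) theorem `reducePointMonoidHom_left_eq_frobenius_comp_of_frobeniusAt` of
`Motives/ProperIntegralPointsFrobeniusTranslate` (reduction through the global valuation ring `ℤ̄_{𝔓₀} ⊆ K̄` on which `σ̃`
acts with residue action `y ↦ y^{pⁿ}`), by uniqueness of extensions over `(R, f ∘ γᵥ)` (`extendPoint_eq_iff`).  Consequences: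

* `GoodReductionAt.slotT3_of_frobeniusAt` — (T3″) for `φ := γᵥ = algEquivValuationSubring v γ _` and any `σ̃ ∈ Aut(K̄)` over
  `γ` with `σ̃ x ≡ x^q (mod 𝔓₀)` on `ℤ̄_K`, `q = pⁿ`, `𝔓₀ = adicCompletionPrime K v`;
* `IsAbelianSchemeModel.twistedReductionMap` — **(TW)**: for an abelian-scheme model `𝒜ₐ` of `Aₐ` at `v`, an arithmetic
  Frobenius `γ ∈ Aut(K/F₀)` at `v` with `#κ(v ∩ F₀) = pⁿ` and such a `σ̃`, and every `y ∈ Aₐ(K̄)`: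
  `red_{(𝒜ₐ)^{γᵥ}} (y^σ̃) = π (red_v y)` — the reduction map of the conjugate datum `ha.goodReductionAt.conjFrob γ hγ p n hq`
  at the `σ̃`-conjugate point is the relative `pⁿ`-Frobenius of the reduction of `y` (B-p07's `twistedReductionMap_of_slotT3`
  with its slot discharged);
* `IsAbelianSchemeModel.twistedReductionMap_global` — the same for all data at once: the hypothesis `hTW` of
  `forall_isTateCompatible_homReduction_conjFrob_tateSpecialisation_of_twistedReductionMap`
  (`Motives/AbelianVarietyGoodReductionConjFrobTateCompat`) VERBATIM, whence the named twisted-reduction/Tate-compatibility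
  fact of row II-1 (`IsAbelianSchemeModel.forall_isTateCompatible_homReduction_conjFrob_tateSpecialisation`) by one application.

Every intermediate equation of underlying scheme maps is formed with a syntactic `Spec (.of _)` source on one side (the two
base points `(R, f)` and `(R, f ∘ γᵥ)` never meet in one `Eq`; cf. the kernel notes of `ProperIntegralPointsTwist`).
HC_CM is proved only modulo the 7 printed citations until rung 0 closes.

## References
* [Shimura1998] G. Shimura, *Abelian Varieties with Complex Multiplication and Modular Functions*, Princeton 1998, §18.6,
  proof of Thm. 18.6, p. 129 («`(Y^σ)~ = Ỹ^f`»), p. 130 («`(t^σ)~ = π(t̃)`»); §11.1 Prop. 14 (i).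
* [SerreTate1968] J.-P. Serre, J. Tate, *Good reduction of abelian varieties*, Ann. of Math. 88 (1968), §1 (the reduction
  map; Lemma 2).
* [Hartshorne1977] R. Hartshorne, *Algebraic Geometry*, II.4.7 (valuative criterion of properness).
-/

set_option autoImplicit false

noncomputable section

open CategoryTheory CategoryTheory.Limits AlgebraicGeometry IsDedekindDomain IsDedekindDomain.HeightOneSpectrum
open IsLocalRing
open scoped NumberField Pointwise
open Literature.NumberTheory.GaloisRepresentations Literature.NumberTheory.DiophantineGeometry

namespace Literature.AlgebraicGeometry.Motives

namespace AbelianVariety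

namespace GoodReductionAt

variable {K : Type} [Field K] [NumberField K] (v : HeightOneSpectrum (𝓞 K))

set_option backward.isDefEq.respectTransparency false in
/-- **The base-point Frobenius-translate predicate (T3″) `SlotT3` holds at `φ := γᵥ`** for `γ ∈ Aut(K/F₀)` with `γ • v = v`
and any `σ̃ ∈ Aut(K̄)` over `γ` with `σ̃ x ≡ x^q (mod 𝔓₀)` on `ℤ̄_K` (`q = pⁿ`): given `ξ`, `Q` over `Spec ι ≫ ξ` and an `R`-point
`l` over `(R, f ∘ γᵥ)` with generic point `Spec ι ≫ Spec σ̃ ≫ ξ`, `l mod 𝔪_R = Spec Frobⁿ ≫ (Q mod 𝔪_R)` — `l` is the extension of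
the `Ω`-point `Spec ι ≫ Spec σ̃ ≫ ξ` (uniqueness, [Hartshorne1977] II.4.7) and the (T3) theorem
`reducePointMonoidHom_left_eq_frobenius_comp_of_frobeniusAt` computes its reduction ([Shimura1998] p. 129 «`(Y^σ)~ = Ỹ^f`»).
[cite: Shimura1998, §18.6 proof of Thm. 18.6, p. 129] [cite: Hartshorne1977, II.4.7] -/
theorem slotT3_of_frobeniusAt [(adicCompletionPrime K v).IsMaximal] {F₀ : Type} [Field F₀] [Algebra F₀ K]
    (γ : K ≃ₐ[F₀] K) (hγv : γ • v.asIdeal = v.asIdeal) (p n q : ℕ) (hq : q = p ^ n)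
    (σt : AlgebraicClosure K ≃+* AlgebraicClosure K)
    (hσa : ∀ a : K, σt (algebraMap K (AlgebraicClosure K) a) = algebraMap K (AlgebraicClosure K) (γ.toRingEquiv a))
    (hσ𝔓 : ∀ x : absIntegers (𝓞 K) K, ∃ hx : σt x ∈ absIntegers (𝓞 K) K,
      (⟨σt x, hx⟩ : absIntegers (𝓞 K) K) - x ^ q ∈ adicCompletionPrime K v) :
    SlotT3 v (algEquivValuationSubring v γ hγv).toRingHom σt p n := by
  intro _ 𝒳 _ _ ξ hξ Q hQ l hl₁ hl₂
  -- abbreviations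
  let R := closureValuationSubring (v.adicCompletion K)
  let V := absIntegersValuationSubring (adicCompletionPrime K v)
  let ι : AlgebraicClosure K →+* AlgebraicClosure (v.adicCompletion K) :=
    (absClosureEmbedding K (v.adicCompletion K)).toRingHom
  let φ : valuationSubringAtPrime K v →+* valuationSubringAtPrime K v := (algEquivValuationSubring v γ hγv).toRingHom
  -- the structure map `f' : 𝓞ᵥ → ℤ̄_{𝔓₀}` under `K → K̄`
  let f' : valuationSubringAtPrime K v →+* V :=
    ((algebraMap K (AlgebraicClosure K)).comp (algebraMap (valuationSubringAtPrime K v) K)).codRestrict V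
      fun x => algebraMap_valuationSubringAtPrime_mem_absIntegersValuationSubring v x
  have hf' : ∀ x : valuationSubringAtPrime K v,
      ((f' x : V) : AlgebraicClosure K) = algebraMap K (AlgebraicClosure K) (x : K) := fun _ => rfl
  -- `ξ` as a `K̄`-point of `𝒳` over `(V, f')`
  have hVf' : (algebraMap V (AlgebraicClosure K)).comp f' =
      algebraMap (valuationSubringAtPrime K v) (AlgebraicClosure K) := by
    ext x
    change algebraMap K (AlgebraicClosure K) (x : K) = algebraMap (valuationSubringAtPrime K v) (AlgebraicClosure K) x
    exact (IsScalarTower.algebraMap_apply (valuationSubringAtPrime K v) K (AlgebraicClosure K) x).symm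
  let ξ' : specFractionField V f' ⟶ 𝒳 :=
    Over.homMk (U := specFractionField V f') (V := 𝒳) ξ (by
      change ξ ≫ 𝒳.hom = Spec.map _ ≫ Spec.map _
      rw [hξ, ← Spec.map_comp, ← CommRingCat.ofHom_comp, hVf'])
  -- the twisted `Ω`-point `P' = Spec ι ≫ Spec σ̃ ≫ ξ` over `(R, f ∘ γᵥ)`
  have hring : (ι.comp (σt.toRingHom.comp (algebraMap (valuationSubringAtPrime K v) (AlgebraicClosure K)))) =
      (algebraMap R (AlgebraicClosure (v.adicCompletion K))).comp ((toClosureValuationSubring v).comp φ) := by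
    ext x
    change ι (σt (algebraMap (valuationSubringAtPrime K v) (AlgebraicClosure K) x)) =
      ((toClosureValuationSubring v (algEquivValuationSubring v γ hγv x) : R) : AlgebraicClosure (v.adicCompletion K))
    rw [IsScalarTower.algebraMap_apply (valuationSubringAtPrime K v) K (AlgebraicClosure K), hσa,
      ← absClosureEmbedding_algebraMap_valuationSubringAtPrime v]
    rfl
  let P' : specFractionField R ((toClosureValuationSubring v).comp φ) ⟶ 𝒳 :=
    Over.homMk (U := specFractionField R ((toClosureValuationSubring v).comp φ)) (V := 𝒳)
      (Spec.map (CommRingCat.ofHom ι) ≫ Spec.map (CommRingCat.ofHom σt.toRingHom) ≫ ξ :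
        Spec (.of (AlgebraicClosure (v.adicCompletion K))) ⟶ 𝒳.left) (by
      change (Spec.map _ ≫ Spec.map _ ≫ ξ) ≫ 𝒳.hom = Spec.map _ ≫ Spec.map _
      rw [Category.assoc, Category.assoc, hξ, ← Spec.map_comp, ← Spec.map_comp, ← Spec.map_comp,
        ← CommRingCat.ofHom_comp, ← CommRingCat.ofHom_comp, ← CommRingCat.ofHom_comp, ← hring])
  -- `l` IS the extension of `P'` (uniqueness, `hl₂`)
  let L : specValuationSubring R ((toClosureValuationSubring v).comp φ) ⟶ 𝒳 :=
    Over.homMk (U := specValuationSubring R ((toClosureValuationSubring v).comp φ)) (V := 𝒳) l hl₁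
  have hext : extendPoint R ((toClosureValuationSubring v).comp φ) 𝒳 P' = L := by
    rw [extendPoint_eq_iff]
    ext : 1
    change Spec.map (CommRingCat.ofHom (algebraMap R (AlgebraicClosure (v.adicCompletion K)))) ≫ l =
      Spec.map (CommRingCat.ofHom ι) ≫ Spec.map (CommRingCat.ofHom σt.toRingHom) ≫ ξ
    exact hl₂
  -- (T3) ★ at `ξ'`, `Q`, `P'`
  have hP'' : P'.left = Spec.map (CommRingCat.ofHom (ι.comp σt.toRingHom)) ≫ ξ'.left := by
    change Spec.map (CommRingCat.ofHom ι) ≫ Spec.map (CommRingCat.ofHom σt.toRingHom) ≫ ξ =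
      Spec.map (CommRingCat.ofHom (ι.comp σt.toRingHom)) ≫ ξ
    rw [CommRingCat.ofHom_comp, Spec.map_comp, Category.assoc]
  have h := reducePointMonoidHom_left_eq_frobenius_comp_of_frobeniusAt v γ hγv p n q hq σt hσa hσ𝔓 f' hf' 𝒳 ξ' Q P'
    hQ hP''
  rw [reducePointMonoidHom_apply, reducePointMonoidHom_apply, hext] at h
  exact h



end GoodReductionAt

end AbelianVariety

end Literature.AlgebraicGeometry.Motives

namespace Literature.NumberTheory.DiophantineGeometry

open Literature.AlgebraicGeometry.Motives Literature.AlgebraicGeometry.Motives.AbelianVariety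

variable {K : Type} [Field K] [NumberField K] (v : HeightOneSpectrum (𝓞 K))

/-- `κ(R)` (`R` the valuation ring of `\bar{K_v}`) has the exponential characteristic of `κ(v)`: it is a `κ(v)`-algebra and both
are fields. [cite: SerreTate1968, §1] -/
theorem expChar_residueField_closureValuationSubring (p : ℕ) [ExpChar v.asIdeal.ResidueField p] :
    ExpChar (ResidueField (closureValuationSubring (v.adicCompletion K))) p :=
  expChar_of_injective_algebraMap
    (algebraMap v.asIdeal.ResidueField (ResidueField (closureValuationSubring (v.adicCompletion K)))).injective p

variable {v}

namespace IsAbelianSchemeModel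

/-- **(TW) — the twisted reduction identity `red_{(𝒜ₐ)^{γᵥ}} (y^σ̃) = π (red_v y)`, UNCONDITIONALLY** ([Shimura1998] §18.6
p. 129 «`(Y^σ)~ = Ỹ^f`», p. 130 «`(t^σ)~ = π(t̃)`»; [SerreTate1968] §1): for an abelian-scheme model `𝒜ₐ` of `Aₐ` at `v`, an
arithmetic Frobenius `γ ∈ Aut(K/F₀)` at `v` with `#κ(v ∩ F₀) = pⁿ`, `σ̃ ∈ Aut(K̄)` over `γ` with `σ̃ x ≡ x^{pⁿ} (mod 𝔓₀)` on `ℤ̄_K`,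
and `y ∈ Aₐ(K̄)`, the reduction map of the conjugate datum `ha.goodReductionAt.conjFrob γ hγ p n hq` (model `𝒜ₐ ⊗_{γᵥ} 𝓞ᵥ`,
reduction `Ã^{(pⁿ)}`) at `y^σ̃ = conjTransport … y` is the relative Frobenius `π : Ã → Ã^{(pⁿ)}` applied to `red_v y`
(`twistedReductionMap_of_slotT3` of `Motives/AbelianVarietyGoodReductionConjFrobReductionMap` with its slot discharged by
`GoodReductionAt.slotT3_of_frobeniusAt`). [cite: Shimura1998, §18.6 proof of Thm. 18.6, p. 129] [cite: SerreTate1968, §1 Lemma 2] -/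
theorem twistedReductionMap {F₀ : Type} [Field F₀] [Algebra F₀ K]
    {Aₐ : AbelianVariety K} {𝒜ₐ : SchemeOver (valuationSubringAtPrime K v)} [GrpObj 𝒜ₐ]
    (ha : IsAbelianSchemeModel Aₐ v 𝒜ₐ) (γ : K ≃ₐ[F₀] K) (hγ : IsArithFrobAt (𝓞 F₀) γ v.asIdeal) (p n : ℕ)
    [ExpChar v.asIdeal.ResidueField p] (hq : Nat.card (𝓞 F₀ ⧸ v.asIdeal.under (𝓞 F₀)) = p ^ n)
    (σt : AlgebraicClosure K ≃+* AlgebraicClosure K)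
    (hσa : ∀ a : K, σt (algebraMap K (AlgebraicClosure K) a) = algebraMap K (AlgebraicClosure K) (γ.toRingEquiv a))
    (hσ𝔓 : ∀ x : absIntegers (𝓞 K) K, ∃ hx : σt x ∈ absIntegers (𝓞 K) K,
      (⟨σt x, hx⟩ : absIntegers (𝓞 K) K) - x ^ Nat.card (𝓞 F₀ ⧸ v.asIdeal.under (𝓞 F₀)) ∈ adicCompletionPrime K v)
    (y : Aₐ.geomPoints) :
    (ha.goodReductionAt.conjFrob γ hγ p n hq).geomReductionMap (conjTransport γ.toRingEquiv σt hσa Aₐ y) =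
      Hom.geomPointsMap (ha.specialFibre.relFrobenius p n) (ha.specialFibreReductionHom y) := by
  haveI := expChar_residueField_closureValuationSubring v p
  haveI : (adicCompletionPrime K v).IsMaximal := adicCompletionPrime_isMaximal K v
  exact ha.twistedReductionMap_of_slotT3 γ hγ p n hq σt hσa
    (GoodReductionAt.slotT3_of_frobeniusAt v γ (smul_asIdeal_eq_of_isArithFrobAt v γ hγ) p n _ hq σt hσa hσ𝔓) y

/-- **(TW) for all data at once** — the hypothesis `hTW` of
`IsAbelianSchemeModel.forall_isTateCompatible_homReduction_conjFrob_tateSpecialisation_of_twistedReductionMap`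
(`Motives/AbelianVarietyGoodReductionConjFrobTateCompat`) VERBATIM, as a theorem; one application of that theorem then yields
the named twisted-reduction/Tate-compatibility fact of row II-1. [cite: Shimura1998, §18.6 proof of Thm. 18.6, p. 129; §11.1 Prop. 14 (i)] -/
theorem twistedReductionMap_global :
    ∀ {F₀ K : Type} [Field F₀] [Field K] [NumberField K] [Algebra F₀ K] {v : HeightOneSpectrum (𝓞 K)}
      {Aₐ : AbelianVariety K} {𝒜ₐ : SchemeOver (valuationSubringAtPrime K v)} [GrpObj 𝒜ₐ]
      (ha : IsAbelianSchemeModel Aₐ v 𝒜ₐ) (γ : K ≃ₐ[F₀] K) (hγ : IsArithFrobAt (𝓞 F₀) γ v.asIdeal) (p n : ℕ)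
      [ExpChar v.asIdeal.ResidueField p] (hq : Nat.card (𝓞 F₀ ⧸ v.asIdeal.under (𝓞 F₀)) = p ^ n)
      (σt : AlgebraicClosure K ≃+* AlgebraicClosure K)
      (_hσa : ∀ a : K, σt (algebraMap K (AlgebraicClosure K) a) = algebraMap K (AlgebraicClosure K) (γ.toRingEquiv a))
      (_hσ𝔓 : ∀ x : absIntegers (𝓞 K) K, ∃ hx : σt x ∈ absIntegers (𝓞 K) K,
        (⟨σt x, hx⟩ : absIntegers (𝓞 K) K) - x ^ Nat.card (𝓞 F₀ ⧸ v.asIdeal.under (𝓞 F₀)) ∈ adicCompletionPrime K v)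
      (y : Aₐ.geomPoints),
      (ha.goodReductionAt.conjFrob γ hγ p n hq).geomReductionMap (conjTransport γ.toRingEquiv σt _hσa Aₐ y) =
        Hom.geomPointsMap (ha.specialFibre.relFrobenius p n) (ha.specialFibreReductionHom y) :=
  fun ha γ hγ p n _ hq σt hσa hσ𝔓 y => twistedReductionMap ha γ hγ p n hq σt hσa hσ𝔓 y

end IsAbelianSchemeModel

end Literature.NumberTheory.DiophantineGeometry

end
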